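import Literature.AlgebraicGeometry.Resolution.QuasiExcellentFiniteType
import HarnessLib

/-!
# The G-ring facts of `ExcellentRings.lean` from the single leaf `Stacks07PV`

Topic: `Literature/AlgebraicGeometry/Resolution`. Companion of `QuasiExcellentFiniteType.lean`
(proofs only, no new notions). `ExcellentRings.lean` vendors Matsumura's Corollary to Thm. 32.6
(p. 260: "A ring which is finitely generated over a field, or a localisation of such a ring, is
a G-ring") as the named facts `Matsumura1987_32_6_cor` and — its deep step —
`Matsumura1987_32_polynomial` (`k[X_1, …, X_n]` is a G-ring). Both are special cases of the
named fact `Stacks07PV` (Stacks, Prop. 15.51.10: essentially finite type algebras over G-rings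
are G-rings), a field being a G-ring (`isGRing_of_field`, `ExcellentRingsProofs.lean`). This
file records the implications, so that a discharge of `Stacks07PV` discharges them too:

* `Stacks07PV.matsumura1987_32_polynomial : Stacks07PV → Matsumura1987_32_polynomial`;
* `Stacks07PV.matsumura1987_32_6_cor : Stacks07PV → Matsumura1987_32_6_cor`;
* `Stacks07PV.isGRing_localization_of_finiteType_field` — the localisation half of the
  Corollary.

## Sources

* The Stacks Project, Tag 07PV (= Prop. 15.51.10). [StacksProject]
* H. Matsumura, *Commutative Ring Theory*, CUP 1986, §32 p. 260, Cor. of Thm. 32.6.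
  [Matsumura1987]
-/

noncomputable section

namespace Literature.AlgebraicGeometry.Resolution

universe u

/-- Under `Stacks07PV`, **polynomial rings over a field are G-rings** — the named fact
`Matsumura1987_32_polynomial` (`ExcellentRings.lean`; Matsumura, Cor. of Thm. 32.6 via
Thm. 32.6): a field is a G-ring (`isGRing_of_field`) and `k[X_1, …, X_n]` is of finite type
over `k`. [cite: StacksProject, Tag 07PV] -/
theorem Stacks07PV.matsumura1987_32_polynomial (h : Stacks07PV.{u}) :
    Matsumura1987_32_polynomial.{u} :=
  fun k _ n => h k (MvPolynomial (Fin n) k) (isGRing_of_field k) inferInstance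

/-- Under `Stacks07PV`, **finitely generated algebras over a field are G-rings** — the named
fact `Matsumura1987_32_6_cor` (`ExcellentRings.lean`; Matsumura, Cor. of Thm. 32.6, p. 260).
[cite: StacksProject, Tag 07PV] -/
theorem Stacks07PV.matsumura1987_32_6_cor (h : Stacks07PV.{u}) : Matsumura1987_32_6_cor.{u} :=
  fun k A _ _ _ hA =>
    haveI := hA
    h k A (isGRing_of_field k) inferInstance

/-- Under `Stacks07PV`, the localisation half of Matsumura's Corollary to Thm. 32.6 ("… or a
localisation of such a ring, is a G-ring"): a localisation of a finitely generated algebra over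
a field is a G-ring. [cite: StacksProject, Tag 07PV] -/
theorem Stacks07PV.isGRing_localization_of_finiteType_field (h : Stacks07PV.{u})
    (k A B : Type u) [Field k] [CommRing A] [Algebra k A] [CommRing B] [Algebra A B]
    (S : Submonoid A) [IsLocalization S B] (hA : Algebra.FiniteType k A) : IsGRing B :=
  isGRing_of_isLocalization S (h.matsumura1987_32_6_cor k A hA)

end Literature.AlgebraicGeometry.Resolution

end
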